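import Summits.QuantumFields.BalabanUV.Beta.SpineRecursiveParity
import Summits.QuantumFields.BalabanUV.Beta.SymmetrisedStepJets
import Summits.QuantumFields.BalabanUV.Beta.MultiplierTableSlot
import Summits.QuantumFields.BalabanUV.Beta.KernelWardSymEnd

/-!
# `BalabanUV.Beta.SymmetrisedStepJetsParity` — binder row D1: THE ROW PARITIES (Sp)(Mp) OF THE (0.4) LITERAL's FIRST-ORDER TABLES REDUCED TO THE
# TABLE PARITIES (V-p)(H-p) — the slotted families `SrecOf V H G`, `SpureRecOf V H G`, `M1Of H cΛ` are row-parity-odd (`trK = −sgnK`) at every level as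
# soon as `V`'s and `H`'s rows are and the resolvents are sgn-symmetric; at the symmetrised resolvents `Gsym` the latter is a THEOREM
# (`KernelWardSymEnd.trK_coDressKSymAt_KInvStep`) — slot twin of leaf-05's `SpineRecursiveParity.trK_SrecAt` ∕ `SpineRecursivePureParity.trK_SpureRecAt`
# (β sub-cell, BINDER-OWNERS row D1 OWNER `b2b-balaban-beta-an2`, gen 29; successor brick of [AN2-G29-LANDED-WARD])

HONEST FRAMING (cell charter, verbatim): «discharging BetaPertH makes Bałaban's UV stability UNCONDITIONAL — a real constructive-QFT result; it is
NOT the continuum limit and NOT the Clay problem.»  HONEST DEPENDENCY: continuum YM on T⁴ ⇐ BetaPertH ∧ nine spine estimates (0/9 proved);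
BetaPertH ⇐ (D1) ∧ (D4) ∧ CAP+tail; G-an2-4 gates asym, D1 and NE2/3/4.
NOT IN PRINT; OUR BOOKKEEPING.  [folklore] parity algebra over tree objects BY NAME (leaf-05's `SpineRecursiveParity`: `trK_e3OfK_of_rows`, `trK_wilsonA`,
`parityOdd_SLam`, `parityOdd_smul`∕`_add`); the table parities (V-p) `trK (V κ u) = −sgnK (V κ u)` and (H-p) `trK (H μ y) = −sgnK (H μ y)` are DISPLAYED
HYPOTHESES (for the comb tables they are leaf-05's theorems `trK_vhSAt` ∕ `trK_hessFFAt`; for an1's S_D-mean tables they are letters about VALUES); no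
statement of Bałaban's papers, no `[cite:]`, no `def`, no `def … : Prop`; instantiates NO binder of the β-function wall.  NOT D1, NOT `BetaPertH`, NOT
continuum, NOT Clay.

* §1 slot-generic: **`trK_SrecOf`**, **`trK_SpureRecOf`** (every level; (LV)(LH)(DG), sgn-symmetry of every `G j`, (V-p)(H-p)), **`trK_M1Of`** ((H-p)).
* §2 the literal: **`trK_SsymOf`**, **`trK_SpureSymOf`** (every level, from (V-p)(H-p) of `tabs.V`∕`tabs.H` alone — `Gsym`'s sgn-symmetry discharged).
Provenance: β sub-cell, unit beta-an2 gen 29, 2026-08-21 (v1); over the files named above BY NAME; no existing file touched.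
-/

noncomputable section

open Finset
open scoped BigOperators
open Literature.MathematicalPhysics.QuantumFieldTheory
open Literature.MathematicalPhysics.QuantumFieldTheory.Balaban1983to89
open Literature.MathematicalPhysics.QuantumFieldTheory.Balaban1983to89.Beta
open ExpKernelCalculus (MKer Decays VertexFamily comp)
open AffineAveraging (box toSite)
open AveragingContoursRooted (ctr ctrOff ctrOff_mem_box)
open OneStepResolventKernel (Fib KInv LocStencil)
open OneStepKernelFamily (KInvStep)
open InterLevelTransport (SLam)
open BalabanStepJets (lamCoeffOf)
open BalabanStepJetsSucc (lamCoeffK E2 wE wVH wΛ)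
open StepJetData (wilsonA)
open Summit.QuantumFields.BalabanUV.Beta.TameKernelCalculus
open Summit.QuantumFields.BalabanUV.Beta.AxialDressingRooted (one_le_of_neZero)
open Summit.QuantumFields.BalabanUV.Beta.BorderedHessian (sgnK)
open Summit.QuantumFields.BalabanUV.Beta.BubbleParity (spr_of_decays)
open Summit.QuantumFields.BalabanUV.Beta.KernelWardRemainderParity (parityOdd_add)
open Summit.QuantumFields.BalabanUV.Beta.SpineRecursiveParity (parityOdd_smul trK_e3OfK_of_rows trK_wilsonA parityOdd_SLam)
open Summit.QuantumFields.BalabanUV.Beta.SpineRooted (S0NOf SpureRecOf SpureRecOf_zero_level SpureRecOf_succ locStencil_SrecOf M1Of M1Of_apply)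
open Summit.QuantumFields.BalabanUV.Beta.WardLocusRecursive (SrecOf SrecOf_zero SrecOf_succ)
open Summit.QuantumFields.BalabanUV.Beta.KernelWardSymEnd (trK_coDressKSymAt_KInvStep)
open Summit.QuantumFields.BalabanUV.Beta.SymmetrisedStepJets (SymTables Gsym Gsym_apply decays_Gsym SsymOf SsymOf_eq SpureSymOf)

namespace Summit.QuantumFields.BalabanUV.Beta.SymmetrisedStepJetsParity

variable {d Lc : ℕ} [NeZero Lc]

/-! ## §1 Slot-generic: the recursive families are row-parity-odd from (V-p)(H-p) and the resolvents' sgn-symmetry -/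

section Slot

variable {V H : Fin (d + 1) → (Fin (d + 1) → ℤ) → MKer (d + 1) (Fib d)} {G : ℕ → MKer (d + 1) (Fib d)}

/-- [folklore] **`SrecOf V H G … j` IS ROW-PARITY-ODD AT EVERY LEVEL** under (LV)(LH)(DG), the sgn-symmetry of every `G j`, and the table parities
(V-p)(H-p).  Induction: member `0` = `cE • wilsonA + cVH • V + cΛ • SLam … H` (`trK_wilsonA`, (V-p), `parityOdd_SLam` with (H-p)); member `j+1` = cubic
sector `e3OfK Lc (G j) (SrecOf … j)` (`trK_e3OfK_of_rows` with the induction hypothesis and `locStencil_SrecOf`) + `V` + Λ-sector. -/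
theorem trK_SrecOf (hV : ∀ δ : ℝ, 0 ≤ δ → ∃ C : ℝ, LocStencil V C δ) (hH : ∀ δ : ℝ, 0 ≤ δ → ∃ C : ℝ, VertexFamily H Lc C δ)
    (hG : ∀ j : ℕ, ∃ δ C : ℝ, 0 < δ ∧ 0 ≤ C ∧ Decays (G j) C δ) (hGt : ∀ j : ℕ, trK (G j) = sgnK (G j))
    (hVp : ∀ (κ : Fin (d + 1)) (u : Fin (d + 1) → ℤ), trK (V κ u) = -sgnK (V κ u))
    (hHp : ∀ (μ : Fin (d + 1)) (y : Fin (d + 1) → ℤ), trK (H μ y) = -sgnK (H μ y)) (cE cVH cΛ : ℝ) :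
    ∀ (j : ℕ) (κ : Fin (d + 1)) (u : Fin (d + 1) → ℤ),
      trK (SrecOf d Lc V H G cE cVH cΛ j κ u) = -sgnK (SrecOf d Lc V H G cE cVH cΛ j κ u)
  | 0, κ, u => by
    rw [SrecOf_zero]
    show trK (cE • wilsonA d κ u + cVH • V κ u + cΛ • SLam Lc (lamCoeffOf (KInv (N := Lc) (d := d)) Lc) H κ u) =
      -sgnK (cE • wilsonA d κ u + cVH • V κ u + cΛ • SLam Lc (lamCoeffOf (KInv (N := Lc) (d := d)) Lc) H κ u)
    exact parityOdd_add (parityOdd_add (parityOdd_smul _ (trK_wilsonA κ u)) (parityOdd_smul _ (hVp κ u)))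
      (parityOdd_smul _ (parityOdd_SLam _ _ hHp κ u))
  | j + 1, κ, u => by
    obtain ⟨Cs, δs, hδs, hS⟩ := locStencil_SrecOf (d := d) (one_le_of_neZero Lc) hV hH hG cE cVH cΛ j
    rw [SrecOf_succ]
    exact parityOdd_add (parityOdd_add
      (parityOdd_smul _ (trK_e3OfK_of_rows (spr_of_decays (hG j)) (hGt j) hS hδs (trK_SrecOf hV hH hG hGt hVp hHp cE cVH cΛ j) κ u))
      (parityOdd_smul _ (hVp κ u)))
      (parityOdd_smul _ (parityOdd_SLam _ _ hHp κ u))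

/-- [folklore] **`SpureRecOf V H G … j` IS ROW-PARITY-ODD AT EVERY LEVEL** (same letters): member `0` = `cE • wilsonA + cVH • V`; member `j+1` =
`(cE·wE (j+1)) • e3OfK Lc (G j) (SrecOf … j) + (cVH·wVH (j+1)) • V` (through `trK_SrecOf j`). -/
theorem trK_SpureRecOf (hV : ∀ δ : ℝ, 0 ≤ δ → ∃ C : ℝ, LocStencil V C δ) (hH : ∀ δ : ℝ, 0 ≤ δ → ∃ C : ℝ, VertexFamily H Lc C δ)
    (hG : ∀ j : ℕ, ∃ δ C : ℝ, 0 < δ ∧ 0 ≤ C ∧ Decays (G j) C δ) (hGt : ∀ j : ℕ, trK (G j) = sgnK (G j))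
    (hVp : ∀ (κ : Fin (d + 1)) (u : Fin (d + 1) → ℤ), trK (V κ u) = -sgnK (V κ u))
    (hHp : ∀ (μ : Fin (d + 1)) (y : Fin (d + 1) → ℤ), trK (H μ y) = -sgnK (H μ y)) (cE cVH cΛ : ℝ) :
    ∀ (j : ℕ) (κ : Fin (d + 1)) (u : Fin (d + 1) → ℤ),
      trK (SpureRecOf d Lc V H G cE cVH cΛ j κ u) = -sgnK (SpureRecOf d Lc V H G cE cVH cΛ j κ u)
  | 0, κ, u => by
    rw [SpureRecOf_zero_level]
    exact parityOdd_add (parityOdd_smul _ (trK_wilsonA κ u)) (parityOdd_smul _ (hVp κ u))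
  | j + 1, κ, u => by
    obtain ⟨Cs, δs, hδs, hS⟩ := locStencil_SrecOf (d := d) (one_le_of_neZero Lc) hV hH hG cE cVH cΛ j
    rw [SpureRecOf_succ]
    exact parityOdd_add
      (parityOdd_smul _ (trK_e3OfK_of_rows (spr_of_decays (hG j)) (hGt j) hS hδs (trK_SrecOf hV hH hG hGt hVp hHp cE cVH cΛ j) κ u))
      (parityOdd_smul _ (hVp κ u))

omit [NeZero Lc] in
/-- [folklore] **`M1Of H cΛ j` IS ROW-PARITY-ODD** as soon as `H` is ((H-p); `M1Of_apply`). -/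
theorem trK_M1Of (hHp : ∀ (μ : Fin (d + 1)) (y : Fin (d + 1) → ℤ), trK (H μ y) = -sgnK (H μ y)) (cΛ : ℝ) (j : ℕ) (μ : Fin (d + 1))
    (w : Fin (d + 1) → ℤ) : trK (M1Of d Lc H cΛ j μ w) = -sgnK (M1Of d Lc H cΛ j μ w) := by
  rw [M1Of_apply]
  exact parityOdd_smul _ (hHp μ w)

end Slot

/-! ## §2 The literal: (Sp) from (V-p)(H-p) alone -/

section Literal

/-- [folklore] The symmetrised step resolvents are sgn-symmetric (`KernelWardSymEnd.trK_coDressKSymAt_KInvStep` at the centred root). -/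
theorem trK_Gsym (j : ℕ) : trK (Gsym (d := d) Lc j) = sgnK (Gsym (d := d) Lc j) := by
  rw [Gsym_apply]
  exact trK_coDressKSymAt_KInvStep (d := d) (ctrOff_mem_box (one_le_of_neZero Lc)) j

/-- [folklore] **THE LITERAL's FOLDED FIRST-ORDER TABLES `SsymOf tabs` ARE ROW-PARITY-ODD AT EVERY LEVEL** from (V-p)(H-p) of `tabs.V`∕`tabs.H` alone. -/
theorem trK_SsymOf (tabs : SymTables d Lc)
    (hVp : ∀ (κ : Fin (d + 1)) (u : Fin (d + 1) → ℤ), trK (tabs.V κ u) = -sgnK (tabs.V κ u))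
    (hHp : ∀ (μ : Fin (d + 1)) (y : Fin (d + 1) → ℤ), trK (tabs.H μ y) = -sgnK (tabs.H μ y)) (cE cVH cΛ : ℝ)
    (j : ℕ) (κ : Fin (d + 1)) (u : Fin (d + 1) → ℤ) :
    trK (SsymOf tabs cE cVH cΛ j κ u) = -sgnK (SsymOf tabs cE cVH cΛ j κ u) :=
  trK_SrecOf tabs.hV tabs.hH (decays_Gsym Lc) (fun j => trK_Gsym (d := d) (Lc := Lc) j) hVp hHp cE cVH cΛ j κ u

/-- [folklore] **(Sp) — THE LITERAL's PURE FIRST-ORDER TABLES `SpureSymOf tabs` ARE ROW-PARITY-ODD AT EVERY LEVEL** from (V-p)(H-p) alone. -/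
theorem trK_SpureSymOf (tabs : SymTables d Lc)
    (hVp : ∀ (κ : Fin (d + 1)) (u : Fin (d + 1) → ℤ), trK (tabs.V κ u) = -sgnK (tabs.V κ u))
    (hHp : ∀ (μ : Fin (d + 1)) (y : Fin (d + 1) → ℤ), trK (tabs.H μ y) = -sgnK (tabs.H μ y)) (cE cVH cΛ : ℝ)
    (j : ℕ) (κ : Fin (d + 1)) (u : Fin (d + 1) → ℤ) :
    trK (SpureSymOf tabs cE cVH cΛ j κ u) = -sgnK (SpureSymOf tabs cE cVH cΛ j κ u) :=
  trK_SpureRecOf tabs.hV tabs.hH (decays_Gsym Lc) (fun j => trK_Gsym (d := d) (Lc := Lc) j) hVp hHp cE cVH cΛ j κ u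

end Literal

end Summit.QuantumFields.BalabanUV.Beta.SymmetrisedStepJetsParity

end
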